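import Literature.MathematicalPhysics.QuantumFieldTheory.Balaban1983to89.B9Eq321LandauProjectionZd

/-!
# `Balaban1983to89.B9Eq321LandauNonVacuityZd` — [Balaban1985BackgroundPropagators] (3.21)–(3.23) p. 394: NON-VACUITY of the two companion files
# (`B9Eq321LandauOrthogonalZd`, `B9Eq321LandauProjectionZd`) at a CURVED background — a non-zero Hermitian gauge function in `N_𝔤(Q′(U₀))`, the value
# `(Δ^η_{U₀} δ_{x₀}H)(x₀) = 2d·η⁻²·H ≠ 0` at every background of units, hence `Δ^η_{U₀}N_𝔤(Q′(U₀)) ≠ 0` and the constructed projection `R(U₀) ≠ 0`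
# (referee A2 of READ-13: «trivial inhabitants only»)

statement-level skeleton of published theorems with citation tags; proofs where landed; nothing here is a claim about the
Yang–Mills mass gap

`[Balaban1985BackgroundPropagators]` ("B9", CMP **99** (1985) 389–434) p. 394: (3.21) «R = Δ^η_U N(Q′), N(Q′) = {λ : Q′λ = 0}», (3.23) «Δ^η_U = D^{η*}_U D^η_U»,
(3.18) p. 393 «(Q′λ)(y) = λ(y) for y ∈ Λ₀»; `[Balaban1985RegularSpaces]` ("B8") (1.1) p. 76.

CITATION HEADER (lean-in-tree rule).  Cell `pub-ymgap`, DAG node N06 = [B9], width seat `pub-ymgap-dag-n06-w4` (g0).  WHY: the lane referee's READ-13 of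
`B9Eq321LandauOrthogonalZd` (p584388) notes A2 «trivial inhabitants only» — the orthogonality theorems quantify over gauge functions `λ ∈ N(Q′(U₀))` and were
exercised in-file only at `λ = 0`; `B9Eq321LandauProjectionZd` (p585863) proves `R(U₀)w = w` on the range but exhibits no non-zero `w`.  THIS FILE supplies the
non-trivial inhabitants at EVERY background: §1 the covariant Laplacian of a one-site function at its site, `(Δ^η_{U₀}(δ_{x₀}·H))(x₀) = (2d·η⁻²)·H` (the
transports cancel: `R(U)⁻¹R(U)H = H`) — non-zero for `H ≠ 0`, `d ≥ 1`, `η ≠ 0`; §2 at truncation `m = 0` every Hermitian `δ_{x₀}·H` with `x₀ ∈ Ω₀ ∖ Λ₀` lies in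
`N_𝔤(Q′(U₀))` (`(Q′₀λ)(y) = λ(y)` vanishes on `Λ₀`), so `B9Eq321LandauOrthogonalZd`'s hypotheses `hsupp ∕ hQ` have a non-zero inhabitant and
`B9Eq321LandauProjectionZd.rangeSub` a non-zero element; §3 hence `R(U₀) = projE … ≠ 0` (a faithful Hermitian trace, finite-dimensional fibre).

WHAT IS PROVED (kernel, 0 sorry; theorems only).  `covDerivFwd_single_self`, `covDerivFwd_single_pred`, ★ `covLap_single_self` (§1); `single_mem_gaugeNull_zero`,
★ `indicator_covLap_single_mem_rangeGen`, `indicator_covLap_single_ne_zero` (§2); ★★ `rangeSub_ne_bot_zero`, ★★ `projE_ne_zero`, ★ `projE_apply_isSelfAdjoint`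
(`R(U₀)` lands in `L²(Ω₀, 𝔤)` at a unitary background) (§3); §4 `finsum_trace_covLap_mul_indicator_eq_zero_of_multiplier`,
★★ `projR_covDivB_sub_eq_zero_of_isLandau146` (the source form (1.146): `R(U₀)(D^{η*}_{U₀}A − f) = 0` for the constructed `R(U₀)`).

HONEST SCOPE.  Non-vacuity bookkeeping only; no estimate; truncation `m = 0` for the `N(Q′)` inhabitant (at `m ≥ 1` the ancestors of `x₀` must avoid the
`Λ_j` — not typed); count-neutral; N05 ∕ N06 NOT discharged; one finite `𝕋⁴` programme at fixed `ε`, Bałaban as printed; R4 closes only the conditional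
finite-`𝕋⁴` rung `BalabanLadder.UV` — nothing continuum ∕ ℝ⁴ ∕ OS ∕ mass gap ∕ Clay.  Unit `pub-ymgap-dag-n06-w4` (g0), 2026-08-27∕28.
-/

noncomputable section

namespace Literature.MathematicalPhysics.QuantumFieldTheory.Balaban1983to89.B9Eq321LandauNonVacuityZd

open B7Prop1Explicit B7Eq78Linearization
open B7Prop2Explicit (unitaryUnits)
open B8Ineq132 (covDeriv covDerivFwd)
open B8Eq119TwistedAxial (bgT)
open B8Eq138LandauZd (covDivB covLap)
open B9Eq321LandauProjectionZd (suppSub formE gaugeNull rangeGen rangeSub projE indicator_mem_suppSub projE_apply_of_mem_range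
  projE_apply_mem_range)

-- `Site` alone could resolve to the torus sites of `Setup.lean`; re-export the `ℤ^d` sites of `B7Prop1Explicit`.
export B7Prop1Explicit (Site)

variable {d : ℕ} {𝔸 : Type*} [CStarAlgebra 𝔸]

/-! ## §1  The covariant Laplacian of a one-site function at its site -/

section Laplacian

variable (η : ℝ) (U₀ : Site d → Fin d → 𝔸ˣ) (x₀ : Site d) (H : 𝔸)

omit [CStarAlgebra 𝔸] in
/-- `e_μ ≠ 0` on `ℤᵈ`. [folklore] -/
private theorem e_ne_zero (μ : Fin d) : (e μ : Site d) ≠ 0 := by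
  intro h
  have := congr_fun h μ
  simp [e] at this

/-- `(D^η_{U₀,μ} δ_{x₀}H)(x₀) = −η⁻¹·H` (the forward neighbour carries no mass). [cite: Balaban1985RegularSpaces, (1.1) p.76] -/
theorem covDerivFwd_single_self (μ : Fin d) : covDerivFwd η U₀ μ (Pi.single x₀ H) x₀ = -(η⁻¹ • H) := by
  have hne : x₀ + e μ ≠ x₀ := by
    intro h; exact e_ne_zero μ (by simpa using h)
  simp only [covDerivFwd, Pi.single_eq_of_ne hne, Pi.single_eq_same, smul_sub]
  simp [conjR]

/-- `(D^η_{U₀,μ} δ_{x₀}H)(x₀ − e_μ) = η⁻¹·R(U₀(x₀ − e_μ, x₀))H` (the transported mass at `x₀`). [cite: Balaban1985RegularSpaces, (1.1) p.76] -/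
theorem covDerivFwd_single_pred (μ : Fin d) :
    covDerivFwd η U₀ μ (Pi.single x₀ H) (x₀ - e μ) = η⁻¹ • conjR (U₀ (x₀ - e μ) μ) H := by
  have hne : x₀ - e μ ≠ x₀ := by
    intro h; exact e_ne_zero μ (by simpa using h)
  simp only [covDerivFwd, sub_add_cancel, Pi.single_eq_same, Pi.single_eq_of_ne hne, sub_zero]

/-- ★ **`(Δ^η_{U₀}(δ_{x₀}·H))(x₀) = (2d·η⁻²)·H` AT EVERY BACKGROUND OF UNITS** ((3.23) `Δ^η_U = Σ_μ D^{η*}_{U,μ}D^η_{U,μ}`: each direction contributes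
`η⁻¹(R(U)⁻¹(η⁻¹R(U)H) + η⁻¹H) = 2η⁻²H` — the transports cancel). [cite: Balaban1985BackgroundPropagators, (3.23) p.394; Balaban1985RegularSpaces, (1.1) p.76] -/
theorem covLap_single_self : covLap η U₀ (Pi.single x₀ H) x₀ = ((2 * d : ℝ) * (η⁻¹ * η⁻¹)) • H := by
  have hterm : ∀ μ : Fin d, covDeriv η U₀ μ (covDerivFwd η U₀ μ (Pi.single x₀ H)) x₀ = ((2 : ℝ) * (η⁻¹ * η⁻¹)) • H := by
    intro μ
    rw [covDeriv, covDerivFwd_single_pred, covDerivFwd_single_self, conjR_smul_real]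
    have hc : conjR (U₀ (x₀ - e μ) μ)⁻¹ (conjR (U₀ (x₀ - e μ) μ) H) = H := by
      simp [conjR, mul_assoc]
    rw [hc, sub_neg_eq_add, ← two_smul ℝ (η⁻¹ • H), smul_smul, smul_smul]
    ring_nf
  simp only [covLap, covDivB, hterm, Finset.sum_const, Finset.card_univ, Fintype.card_fin]
  rw [← Nat.cast_smul_eq_nsmul ℝ, smul_smul]
  ring_nf

/-- … so it is NON-ZERO for `H ≠ 0`, `d ≥ 1`, `η ≠ 0`. [cite: Balaban1985BackgroundPropagators, (3.23) p.394] -/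
theorem covLap_single_self_ne_zero (hd : 0 < d) (hη : η ≠ 0) (hH : H ≠ 0) : covLap η U₀ (Pi.single x₀ H) x₀ ≠ 0 := by
  rw [covLap_single_self]
  set c : ℝ := (2 * d : ℝ) * (η⁻¹ * η⁻¹) with hc
  have hd' : (0 : ℝ) < d := by exact_mod_cast hd
  have hη2 : (0 : ℝ) < η⁻¹ * η⁻¹ := mul_self_pos.2 (inv_ne_zero hη)
  have hcne : c ≠ 0 := (mul_pos (mul_pos two_pos hd') hη2).ne'
  intro h0
  have h1 : c⁻¹ • (c • H) = 0 := by rw [h0, smul_zero]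
  rw [smul_smul, inv_mul_cancel₀ hcne, one_smul] at h1
  exact hH h1

end Laplacian

/-! ## §2  A non-zero Hermitian gauge function in `N_𝔤(Q′(U₀))` at truncation `0`, and its non-zero image under `Δ^η_{U₀}` -/

section Null

variable (s : Finset (Site d)) (L : ℕ) (η : ℝ) (Λs : ℕ → Set (Site d)) (U₀ : Site d → Fin d → 𝔸ˣ)

/-- ★ **`δ_{x₀}·H ∈ N_𝔤(Q′(U₀))` AT TRUNCATION `m = 0`** for Hermitian `H`, `x₀ ∈ Ω₀ ∖ Λ₀` («(Q′λ)(y) = λ(y) for y ∈ Λ₀», (3.18): the only condition is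
`λ = 0` on `Λ₀`). [cite: Balaban1985BackgroundPropagators, (3.18) p.393, (3.21) p.394] -/
theorem single_mem_gaugeNull_zero {x₀ : Site d} (hx : x₀ ∈ s) (hΛ : x₀ ∉ Λs 0) {H : 𝔸} (hH : IsSelfAdjoint H) :
    (Pi.single x₀ H : Site d → 𝔸) ∈ gaugeNull s L 0 Λs U₀ := by
  refine ⟨fun x => ?_, fun x hxs => ?_, fun j hj y hy => ?_⟩
  · by_cases h : x = x₀
    · subst h; rwa [Pi.single_eq_same]
    · rw [Pi.single_eq_of_ne h]; exact IsSelfAdjoint.zero 𝔸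
  · exact Pi.single_eq_of_ne (by rintro rfl; exact hxs hx) _
  · obtain rfl : j = 0 := Nat.le_zero.1 hj
    show (Pi.single x₀ H : Site d → 𝔸) y = 0
    exact Pi.single_eq_of_ne (by rintro rfl; exact hΛ hy) _

/-- ★ the generator `𝟙_{Ω₀}Δ^η_{U₀}(δ_{x₀}H)` of `R = Δ^η_{U₀}N_𝔤(Q′(U₀))` (truncation `0`). [cite: Balaban1985BackgroundPropagators, (3.21) p.394] -/
theorem indicator_covLap_single_mem_rangeGen {x₀ : Site d} (hx : x₀ ∈ s) (hΛ : x₀ ∉ Λs 0) {H : 𝔸} (hH : IsSelfAdjoint H) :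
    (⟨(↑s : Set (Site d)).indicator (covLap η U₀ (Pi.single x₀ H)), indicator_mem_suppSub s _⟩ : suppSub (𝔸 := 𝔸) s) ∈
      rangeGen s L 0 η Λs U₀ :=
  ⟨Pi.single x₀ H, single_mem_gaugeNull_zero s L Λs U₀ hx hΛ hH, rfl⟩

/-- … and it is NON-ZERO (`H ≠ 0`, `d ≥ 1`, `η ≠ 0`): its value at `x₀ ∈ Ω₀` is `(2d·η⁻²)·H`. [cite: Balaban1985BackgroundPropagators, (3.21), (3.23) p.394] -/
theorem indicator_covLap_single_ne_zero (hd : 0 < d) (hη : η ≠ 0) {x₀ : Site d} (hx : x₀ ∈ s) {H : 𝔸} (hH0 : H ≠ 0) :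
    (⟨(↑s : Set (Site d)).indicator (covLap η U₀ (Pi.single x₀ H)), indicator_mem_suppSub s _⟩ : suppSub (𝔸 := 𝔸) s) ≠ 0 := by
  intro h
  have h' := congr_arg (fun f : suppSub (𝔸 := 𝔸) s => (f : Site d → 𝔸) x₀) h
  simp only [Submodule.coe_zero, Pi.zero_apply, Set.indicator_of_mem (Finset.mem_coe.2 hx)] at h'
  exact covLap_single_self_ne_zero η U₀ x₀ H hd hη hH0 h'

end Null

/-! ## §3  `Δ^η_{U₀}N_𝔤(Q′(U₀)) ≠ 0` and `R(U₀) ≠ 0` -/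

section Range

variable {τ : 𝔸 →ₗ[ℂ] ℂ} {s : Finset (Site d)} {L : ℕ} {η : ℝ} {Λs : ℕ → Set (Site d)} {U₀ : Site d → Fin d → 𝔸ˣ}

/-- ★★ **`R = Δ^η_{U₀}N_𝔤(Q′(U₀)) ≠ 0` AT EVERY BACKGROUND OF UNITS** (truncation `0`, `d ≥ 1`, `η ≠ 0`, some `x₀ ∈ Ω₀ ∖ Λ₀`, a non-zero Hermitian `H` —
e.g. `H = 1` in a non-trivial fibre). [cite: Balaban1985BackgroundPropagators, (3.21) p.394] -/
theorem rangeSub_ne_bot_zero (hd : 0 < d) (hη : η ≠ 0) {x₀ : Site d} (hx : x₀ ∈ s) (hΛ : x₀ ∉ Λs 0) {H : 𝔸} (hH : IsSelfAdjoint H)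
    (hH0 : H ≠ 0) : rangeSub (𝔸 := 𝔸) s L 0 η Λs U₀ ≠ ⊥ := by
  intro h
  have hmem : (⟨(↑s : Set (Site d)).indicator (covLap η U₀ (Pi.single x₀ H)), indicator_mem_suppSub s _⟩ : suppSub (𝔸 := 𝔸) s) ∈
      rangeSub (𝔸 := 𝔸) s L 0 η Λs U₀ :=
    Submodule.subset_span (indicator_covLap_single_mem_rangeGen s L η Λs U₀ hx hΛ hH)
  rw [h, Submodule.mem_bot] at hmem
  exact indicator_covLap_single_ne_zero s η U₀ hd hη hx hH0 hmem

/-- ★★ **THE CONSTRUCTED PROJECTION `R(U₀)` IS NOT THE ZERO MAP** (faithful Hermitian trace, finite-dimensional fibre; truncation `0`, `d ≥ 1`, `η ≠ 0`, some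
`x₀ ∈ Ω₀ ∖ Λ₀`, a non-zero Hermitian `H`): it fixes the non-zero range element of §2. [cite: Balaban1985BackgroundPropagators, (3.21)–(3.22) p.394] -/
theorem projE_ne_zero [FiniteDimensional ℝ 𝔸] (hτs : ∀ a : 𝔸, τ (star a) = starRingEnd ℂ (τ a))
    (hτp : ∀ a : 𝔸, a ≠ 0 → 0 < (τ (star a * a)).re) (hd : 0 < d) (hη : η ≠ 0) {x₀ : Site d} (hx : x₀ ∈ s) (hΛ : x₀ ∉ Λs 0)
    {H : 𝔸} (hH : IsSelfAdjoint H) (hH0 : H ≠ 0) : projE τ s L 0 η Λs U₀ ≠ 0 := by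
  intro h
  set w : suppSub (𝔸 := 𝔸) s := ⟨(↑s : Set (Site d)).indicator (covLap η U₀ (Pi.single x₀ H)), indicator_mem_suppSub s _⟩ with hw
  have hmem : w ∈ rangeSub (𝔸 := 𝔸) s L 0 η Λs U₀ :=
    Submodule.subset_span (indicator_covLap_single_mem_rangeGen s L η Λs U₀ hx hΛ hH)
  have hfix := projE_apply_of_mem_range (τ := τ) (s := s) L 0 η Λs U₀ hτs hτp hmem
  rw [h, LinearMap.zero_apply] at hfix
  exact indicator_covLap_single_ne_zero s η U₀ hd hη hx hH0 hfix.symm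

/-- ★ **`R(U₀)` LANDS IN `L²(Ω₀, 𝔤)` AT A UNITARY BACKGROUND**: every value of `R(U₀)f` is Hermitian (for ANY `f`), since the range
`Δ^η_{U₀}N_𝔤(Q′(U₀))` is spanned over `ℝ` by Hermitian-valued functions (`star_covLap_of_isSelfAdjoint`) — print's `R(U)` acts on `𝔤`-valued functions.
[cite: Balaban1985BackgroundPropagators, (3.21) p.394 («the Hilbert space L²(Ω₀, 𝔤)»)] -/
theorem projE_apply_isSelfAdjoint {m : ℕ} [FiniteDimensional ℝ 𝔸] (hτs : ∀ a : 𝔸, τ (star a) = starRingEnd ℂ (τ a))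
    (hτp : ∀ a : 𝔸, a ≠ 0 → 0 < (τ (star a * a)).re) (hU : ∀ (x : Site d) (κ : Fin d), U₀ x κ ∈ unitaryUnits 𝔸)
    (f : suppSub (𝔸 := 𝔸) s) (x : Site d) : IsSelfAdjoint (((projE τ s L m η Λs U₀ f : suppSub (𝔸 := 𝔸) s) : Site d → 𝔸) x) := by
  have hmem := projE_apply_mem_range (τ := τ) (s := s) L m η Λs U₀ hτs hτp f
  -- Hermitian-valuedness is closed under the real span
  suffices h : ∀ w ∈ rangeSub (𝔸 := 𝔸) s L m η Λs U₀, ∀ y, IsSelfAdjoint ((w : Site d → 𝔸) y) from h _ hmem x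
  intro w hw
  induction hw using Submodule.span_induction with
  | mem w hw =>
    intro y
    obtain ⟨lam, ⟨hsa, -, -⟩, hwlam⟩ := hw
    rw [hwlam]
    by_cases hy : y ∈ (↑s : Set (Site d))
    · rw [Set.indicator_of_mem hy]
      show star (covLap η U₀ lam y) = covLap η U₀ lam y
      exact B9Eq321LandauProjectionZd.star_covLap_of_isSelfAdjoint η hU hsa y
    · rw [Set.indicator_of_notMem hy]
      exact IsSelfAdjoint.zero 𝔸
  | zero => intro y; rw [Submodule.coe_zero, Pi.zero_apply]; exact IsSelfAdjoint.zero 𝔸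
  | add w₁ w₂ _ _ h₁ h₂ => intro y; rw [Submodule.coe_add, Pi.add_apply]; exact (h₁ y).add (h₂ y)
  | smul c w _ hw => intro y; rw [Submodule.coe_smul, Pi.smul_apply]; exact (IsSelfAdjoint.all c).smul (hw y)

end Range

/-! ## §4  The source form (1.146) for the constructed `R(U₀)`: `R(U₀)(D^{η*}_{U₀}A − f) = 0` -/

section Source

variable {τ : 𝔸 →ₗ[ℂ] ℂ} {s : Finset (Site d)} {L m : ℕ} [NeZero L] {η : ℝ} {Λs : ℕ → Set (Site d)} {U₀ : Site d → Fin d → 𝔸ˣ}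

/-- the generic multiplier identity of `B9Eq321LandauOrthogonalZd` in the tracial currency: `Δ^η_{U₀}(𝟙_{Ω₀}φ) = Q′(U₀)ᵀμ` on the finite `Ω₀` ⟹
`Σᶠ_x τ((Δ^η_{U₀}λ)(x)·(𝟙_{Ω₀}φ)(x)) = 0` for every `λ` of `N(Q′(U₀))`, at every background of units. [cite: Balaban1985RegularSpaces, (1.38) p.82, (1.146) p.101; Balaban1985BackgroundPropagators, (3.21) p.394] -/
theorem finsum_trace_covLap_mul_indicator_eq_zero_of_multiplier (τ : 𝔸 →ₗ[ℂ] ℂ) (hτt : ∀ a b : 𝔸, τ (a * b) = τ (b * a))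
    {Ω₀ : Set (Site d)} (hΩ : Ω₀.Finite) {φ : Site d → 𝔸} {μ : ℕ → Site d → 𝔸}
    (hμ : ∀ x ∈ Ω₀, covLap η U₀ (Ω₀.indicator φ) x = B8Eq138LandauZd.QT L m Λs U₀ μ x)
    {lam : Site d → 𝔸} (hsupp : ∀ x, x ∉ Ω₀ → lam x = 0)
    (hQ : ∀ j, j ≤ m → ∀ y ∈ Λs j, QprimeIter (zdBlocking d L) (bgT L U₀) j lam y = 0) :
    ∑ᶠ x, τ (covLap η U₀ lam x * Ω₀.indicator φ x) = 0 := by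
  have key := B9Eq321LandauOrthogonalZd.finsum_pair_covLap_indicator_eq_zero_of_multiplier
    ((LinearMap.mul ℝ 𝔸).compr₂ (τ.restrictScalars ℝ)) ⊤
    (fun u _ a b => by simpa using B9Eq321LandauOrthogonalZd.trace_mul_conjR τ hτt u a b)
    (fun _ _ => Subgroup.mem_top _) (fun _ _ _ => Subgroup.mem_top _) hΩ hμ hsupp hQ
  simpa using key

/-- ★★ **THE SOURCE FORM (1.146) FOR THE CONSTRUCTED PROJECTION**: if `A` satisfies the multiplier form of «R(U₀)D^{η*}_{U₀}A = f» (`IsLandau146`: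
`f ∈ R(U₀)` and `Δ^η_{U₀}↾Ω₀(D^{η*}_{U₀}A − f) = Q′(U₀)ᵀμ`), then `R(U₀)(D^{η*}_{U₀}A − f) = 0` for `R(U₀) = projR …` (faithful Hermitian tracial `τ`,
finite-dimensional fibre, unitary `U₀`). [cite: Balaban1985RegularSpaces, (1.146) p.101; Balaban1985BackgroundPropagators, (3.20)–(3.22) p.394] -/
theorem projR_covDivB_sub_eq_zero_of_isLandau146 [FiniteDimensional ℝ 𝔸] (hτt : ∀ a b : 𝔸, τ (a * b) = τ (b * a))
    (hτs : ∀ a : 𝔸, τ (star a) = starRingEnd ℂ (τ a)) (hτp : ∀ a : 𝔸, a ≠ 0 → 0 < (τ (star a * a)).re)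
    (hU : ∀ (x : Site d) (κ : Fin d), U₀ x κ ∈ unitaryUnits 𝔸) {f : Site d → 𝔸} {A : Site d → Fin d → 𝔸}
    (h : B8Eq138LandauZd.IsLandau146 L m η (↑s : Set (Site d)) Λs U₀ f A) :
    B9Eq321LandauProjectionZd.projR τ s L m η Λs U₀ (covDivB η U₀ A - f) = 0 := by
  obtain ⟨-, μ, hμ⟩ := h
  -- `𝟙_s(D*A − f) ∈ R^⊥`
  have horth : (⟨(↑s : Set (Site d)).indicator (covDivB η U₀ A - f), indicator_mem_suppSub s _⟩ : suppSub (𝔸 := 𝔸) s) ∈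
      (formE τ s).orthogonal (rangeSub s L m η Λs U₀) := by
    rw [LinearMap.BilinForm.mem_orthogonal_iff]
    intro w hw
    induction hw using Submodule.span_induction with
    | mem w hw =>
      obtain ⟨lam, ⟨hsa, hsupp, hQ⟩, hwlam⟩ := hw
      rw [B9Eq321LandauProjectionZd.formE_apply, hwlam]
      have key := finsum_trace_covLap_mul_indicator_eq_zero_of_multiplier (L := L) τ hτt s.finite_toSet hμ
        (fun x hx => hsupp x fun hx' => hx (Finset.mem_coe.2 hx')) hQ
      have hsup : (Function.support fun x =>
          τ (covLap η U₀ lam x * (↑s : Set (Site d)).indicator (covDivB η U₀ A - f) x)) ⊆ ↑s := by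
        intro x hx
        rw [Function.mem_support] at hx
        by_contra hxs
        exact hx (by rw [Set.indicator_of_notMem hxs, mul_zero, map_zero])
      rw [finsum_eq_sum_of_support_subset _ hsup] at key
      have hre := congrArg Complex.re key
      rw [Complex.re_sum, Complex.zero_re] at hre
      rw [← hre]
      refine Finset.sum_congr rfl fun x hx => ?_
      have hxs : x ∈ (↑s : Set (Site d)) := Finset.mem_coe.2 hx
      rw [Set.indicator_of_mem hxs, B9Eq321LandauProjectionZd.star_covLap_of_isSelfAdjoint η hU hsa]
    | zero => rw [map_zero, LinearMap.zero_apply]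
    | add w₁ w₂ _ _ h₁ h₂ => rw [map_add, LinearMap.add_apply, h₁, h₂, add_zero]
    | smul c w _ hw => rw [map_smul, LinearMap.smul_apply, hw, smul_zero]
  rw [B9Eq321LandauProjectionZd.projR,
    B9Eq321LandauProjectionZd.projE_apply_of_mem_orthogonal L m η Λs U₀ hτs hτp horth]
  rfl

end Source

end Literature.MathematicalPhysics.QuantumFieldTheory.Balaban1983to89.B9Eq321LandauNonVacuityZd

end
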